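import Literature.Analysis.FluidPDE.HeatDivFormGradientL2
import HarnessLib

/-!
# Represented spatial derivatives of space–time functions (bookkeeping for bootstraps)

Analysis/FluidPDE definitions file. In a regularity bootstrap for a distributional solution
(Serrin 1962; Lemarié-Rieusset 2016, Thm. 13.1; Seregin–Šverák 2009, §2 p. 8: "`z ↦ ∇ᵏv(z)` is
Hölder continuous … Proof of this statements can be done by induction") the objects of the
induction are *functions representing distributional space derivatives* of a few base fields
(the velocity components `u_b`, the entries `A_{bc}` of `∇u - ∇uᵀ`, the vorticity fluxes): at
each level one more derivative is shown to be represented by a function with better and better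
integrability. This file fixes the (elementary, Mathlib-free) bookkeeping once, for scalar
space–time functions on `ℝ × E`:

* `derivs vs ψ` — the iterated spatial directional derivative of a space–time test function
  `ψ : ℝ → E → F` along the list of directions `vs : List E`, the head of the list being applied
  **first** (innermost): `derivs (v :: vs) ψ = derivs vs (∂ᵥψ)`, `∂ᵥψ (t, x) = D(ψ t)(x) v`;
* `IsRepDeriv Q h vs f` — "`f` represents the distributional derivative `∂^{vs} h` on the open
  set `Q`": `f` is locally integrable on `Q` and `∫ h · derivs vs ψ = (-1)^{|vs|} ∫ f ψ` for every
  space–time test function `ψ` on `Q` (Schwartz 1950, Ch. II §1: derivative of a distribution;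
  Evans, *PDE*, §5.2.1 for `|vs| = 1`).

and proves the formal rules: test functions are stable under `derivs` (`IsSpaceTimeTestOn.derivs`,
from the tree's `NSSpinHeat.isSpaceTimeTestOn_fderiv_apply`),
`derivs` of appended lists, the zeroth case, **the step** `IsRepDeriv.cons` (a weak partial
derivative of a representative of `∂^{vs} h` represents `∂^{v :: vs} h` — the induction step of
every bootstrap), restriction to smaller open sets, linearity, and **uniqueness a.e.**
(`IsRepDeriv.ae_eq`, du Bois-Reymond). Deeper rules (commutation of `derivs` with `Δ` and `∂ₜ` on
test functions, differentiated weak equations, the product rule) are proved in sequel files.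

## References

* L. Schwartz, *Théorie des distributions* (1950–51), Ch. II §1 (dérivation). [folklore]
* L. C. Evans, *Partial Differential Equations*, 2nd ed. (2010), §5.2.1. [`Evans2010`]
* J. Serrin, Arch. Rational Mech. Anal. 9 (1962) 187–195; P. G. Lemarié-Rieusset, *The
  Navier–Stokes Problem in the 21st Century* (2016), Thm. 13.1. [`LemarieRieusset2016`]
-/

noncomputable section

open MeasureTheory Set Function Filter Topology TopologicalSpace Metric
open scoped NNReal ENNReal

namespace Literature.Analysis.FluidPDE

namespace RepDeriv

section Derivs

variable {E : Type*} [NormedAddCommGroup E] [NormedSpace ℝ E]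
variable {F : Type*} [NormedAddCommGroup F] [NormedSpace ℝ F]

/-- **Iterated spatial directional derivatives of a space–time field** along a list of directions,
the head applied first: `derivs [] ψ = ψ`, `derivs (v :: vs) ψ = derivs vs (∂ᵥψ)` with
`(∂ᵥψ) t x = D(ψ t)(x) v` (Schwartz 1950, Ch. II §1). [folklore] -/
def derivs : List E → (ℝ → E → F) → (ℝ → E → F)
  | [], ψ => ψ
  | v :: vs, ψ => derivs vs (fun t x => fderiv ℝ (ψ t) x v)

/-- `derivs [] ψ = ψ`. [folklore] -/
@[simp]
theorem derivs_nil (ψ : ℝ → E → F) : derivs ([] : List E) ψ = ψ := rfl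

/-- `derivs (v :: vs) ψ = derivs vs (∂ᵥψ)`. [folklore] -/
@[simp]
theorem derivs_cons (v : E) (vs : List E) (ψ : ℝ → E → F) :
    derivs (v :: vs) ψ = derivs vs (fun t x => fderiv ℝ (ψ t) x v) := rfl

/-- `derivs [v] ψ = ∂ᵥψ`. [folklore] -/
theorem derivs_singleton (v : E) (ψ : ℝ → E → F) :
    derivs [v] ψ = fun t x => fderiv ℝ (ψ t) x v := rfl

/-- **Appending a direction applies it last (outermost)**:
`derivs (vs ++ [v]) ψ = ∂ᵥ(derivs vs ψ)`. [folklore] -/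
theorem derivs_append_singleton (vs : List E) (v : E) (ψ : ℝ → E → F) :
    derivs (vs ++ [v]) ψ = fun t x => fderiv ℝ (derivs vs ψ t) x v := by
  induction vs generalizing ψ with
  | nil => rfl
  | cons w ws ih => exact ih _

/-- `derivs (vs ++ ws) ψ = derivs ws (derivs vs ψ)`. [folklore] -/
theorem derivs_append (vs ws : List E) (ψ : ℝ → E → F) :
    derivs (vs ++ ws) ψ = derivs ws (derivs vs ψ) := by
  induction vs generalizing ψ with
  | nil => rfl
  | cons w ws' ih => exact ih _

/-- `derivs` is additive in the field. [folklore] -/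
theorem derivs_add (vs : List E) {ψ₁ ψ₂ : ℝ → E → F}
    (h₁ : ContDiff ℝ ((⊤ : ℕ∞) : WithTop ℕ∞) (uncurry ψ₁))
    (h₂ : ContDiff ℝ ((⊤ : ℕ∞) : WithTop ℕ∞) (uncurry ψ₂)) :
    derivs vs (fun t x => ψ₁ t x + ψ₂ t x) = fun t x => derivs vs ψ₁ t x + derivs vs ψ₂ t x := by
  induction vs generalizing ψ₁ ψ₂ with
  | nil => rfl
  | cons v vs ih =>
    have hd₁ : ∀ t, Differentiable ℝ (ψ₁ t) := fun t =>
      (h₁.comp (contDiff_prodMk_right t)).differentiable (by simp)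
    have hd₂ : ∀ t, Differentiable ℝ (ψ₂ t) := fun t =>
      (h₂.comp (contDiff_prodMk_right t)).differentiable (by simp)
    have hs₁ : ContDiff ℝ ((⊤ : ℕ∞) : WithTop ℕ∞) (uncurry fun t x => fderiv ℝ (ψ₁ t) x v) := by
      have h := (IsSmoothSpaceTimeOn.isSmoothSpaceTimeOn_fderiv_apply (S := univ) (w := ψ₁)
        (by rw [IsSmoothSpaceTimeOn, univ_prod_univ, contDiffOn_univ]; exact h₁) isOpen_univ v)
      rw [IsSmoothSpaceTimeOn, univ_prod_univ, contDiffOn_univ] at h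
      exact h
    have hs₂ : ContDiff ℝ ((⊤ : ℕ∞) : WithTop ℕ∞) (uncurry fun t x => fderiv ℝ (ψ₂ t) x v) := by
      have h := (IsSmoothSpaceTimeOn.isSmoothSpaceTimeOn_fderiv_apply (S := univ) (w := ψ₂)
        (by rw [IsSmoothSpaceTimeOn, univ_prod_univ, contDiffOn_univ]; exact h₂) isOpen_univ v)
      rw [IsSmoothSpaceTimeOn, univ_prod_univ, contDiffOn_univ] at h
      exact h
    simp only [derivs_cons]
    have heq : (fun t x => fderiv ℝ (fun x => ψ₁ t x + ψ₂ t x) x v) =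
        fun t x => fderiv ℝ (ψ₁ t) x v + fderiv ℝ (ψ₂ t) x v := by
      funext t x
      rw [show (fun x => ψ₁ t x + ψ₂ t x) = ψ₁ t + ψ₂ t from rfl,
        fderiv_add (hd₁ t x) (hd₂ t x)]
      rfl
    rw [heq]
    exact ih hs₁ hs₂

/-- `derivs` commutes with constant factors. [folklore] -/
theorem derivs_const_mul (vs : List E) (a : ℝ) {ψ : ℝ → E → ℝ}
    (h : ContDiff ℝ ((⊤ : ℕ∞) : WithTop ℕ∞) (uncurry ψ)) :
    derivs vs (fun t x => a * ψ t x) = fun t x => a * derivs vs ψ t x := by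
  induction vs generalizing ψ with
  | nil => rfl
  | cons v vs ih =>
    have hd : ∀ t, Differentiable ℝ (ψ t) := fun t =>
      (h.comp (contDiff_prodMk_right t)).differentiable (by simp)
    have hs : ContDiff ℝ ((⊤ : ℕ∞) : WithTop ℕ∞) (uncurry fun t x => fderiv ℝ (ψ t) x v) := by
      have h' := (IsSmoothSpaceTimeOn.isSmoothSpaceTimeOn_fderiv_apply (S := univ) (w := ψ)
        (by rw [IsSmoothSpaceTimeOn, univ_prod_univ, contDiffOn_univ]; exact h) isOpen_univ v)
      rw [IsSmoothSpaceTimeOn, univ_prod_univ, contDiffOn_univ] at h'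
      exact h'
    simp only [derivs_cons]
    have heq : (fun t x => fderiv ℝ (fun x => a * ψ t x) x v) = fun t x => a * fderiv ℝ (ψ t) x v := by
      funext t x
      rw [show (fun x => a * ψ t x) = fun x => a • ψ t x from rfl, fderiv_fun_const_smul (hd t x)]
      rfl
    rw [heq]
    exact ih hs

end Derivs

section Test

variable {E : Type*} [NormedAddCommGroup E] [InnerProductSpace ℝ E]
variable {F : Type*} [NormedAddCommGroup F] [NormedSpace ℝ F]

/-- **Test fields are stable under `derivs`.** [folklore] -/
theorem _root_.Literature.Analysis.FluidPDE.IsSpaceTimeTestOn.derivs {Q : Opens (ℝ × E)}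
    {ψ : ℝ → E → F} (hψ : IsSpaceTimeTestOn Q ψ) (vs : List E) :
    IsSpaceTimeTestOn Q (derivs vs ψ) := by
  induction vs generalizing ψ with
  | nil => exact hψ
  | cons v vs ih => exact ih (NSSpinHeat.isSpaceTimeTestOn_fderiv_apply hψ v)

end Test

/-! ### Representatives of distributional derivatives -/

section Rep

variable {E : Type*} [NormedAddCommGroup E] [InnerProductSpace ℝ E] [FiniteDimensional ℝ E]
  [MeasurableSpace E] [BorelSpace E]

/-- **`f` represents the distributional spatial derivative `∂^{vs} h` on `Q`** (Schwartz 1950,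
Ch. II §1, `⟨∂^α T, ψ⟩ = (-1)^{|α|} ⟨T, ∂^α ψ⟩`; Evans, *PDE*, §5.2.1 for one derivative): `f` is
locally integrable on the open set `Q ⊆ ℝ × E` and
`∫ h · derivs vs ψ = (-1)^{|vs|} ∫ f ψ` for every space–time test function `ψ` on `Q` (whole-space
integrals; the integrands are supported in `Q`). [folklore] -/
def IsRepDeriv (Q : Opens (ℝ × E)) (h : ℝ × E → ℝ) (vs : List E) (f : ℝ × E → ℝ) : Prop :=
  LocallyIntegrableOn h (Q : Set (ℝ × E)) volume ∧ LocallyIntegrableOn f (Q : Set (ℝ × E)) volume ∧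
    ∀ ψ : ℝ → E → ℝ, IsSpaceTimeTestOn Q ψ →
      ∫ q : ℝ × E, h q * derivs vs ψ q.1 q.2 = (-1) ^ vs.length * ∫ q : ℝ × E, f q * ψ q.1 q.2

variable {Q Q' : Opens (ℝ × E)} {h f f' g : ℝ × E → ℝ} {vs : List E} {v : E}

/-- The base function is locally integrable on `Q`. [folklore] -/
theorem IsRepDeriv.locallyIntegrableOn_base (hf : IsRepDeriv Q h vs f) :
    LocallyIntegrableOn h (Q : Set (ℝ × E)) volume := hf.1

/-- The representative is locally integrable on `Q`. [folklore] -/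
theorem IsRepDeriv.locallyIntegrableOn (hf : IsRepDeriv Q h vs f) :
    LocallyIntegrableOn f (Q : Set (ℝ × E)) volume := hf.2.1

/-- The defining identity. [folklore] -/
theorem IsRepDeriv.integral_eq (hf : IsRepDeriv Q h vs f) {ψ : ℝ → E → ℝ}
    (hψ : IsSpaceTimeTestOn Q ψ) :
    ∫ q : ℝ × E, h q * derivs vs ψ q.1 q.2 = (-1) ^ vs.length * ∫ q : ℝ × E, f q * ψ q.1 q.2 :=
  hf.2.2 ψ hψ

/-- **Order zero**: a locally integrable function represents itself. [folklore] -/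
theorem isRepDeriv_nil (hh : LocallyIntegrableOn h (Q : Set (ℝ × E)) volume) : IsRepDeriv Q h [] h :=
  ⟨hh, hh, fun ψ _ => by simp⟩

/-- **The step.** If `f` represents `∂^{vs} h` on `Q` and `f'`, locally integrable on `Q`, is a weak
partial derivative of `f` in the direction `v` (`∫ f ∂ᵥψ = -∫ f' ψ` for all test functions on `Q`),
then `f'` represents `∂^{v :: vs} h` on `Q`. [folklore] -/
theorem IsRepDeriv.cons (hf : IsRepDeriv Q h vs f)
    (hf' : LocallyIntegrableOn f' (Q : Set (ℝ × E)) volume)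
    (hweak : ∀ ψ : ℝ → E → ℝ, IsSpaceTimeTestOn Q ψ →
      ∫ q : ℝ × E, f q * fderiv ℝ (ψ q.1) q.2 v = -∫ q : ℝ × E, f' q * ψ q.1 q.2) :
    IsRepDeriv Q h (v :: vs) f' := by
  refine ⟨hf.1, hf', fun ψ hψ => ?_⟩
  rw [derivs_cons, hf.integral_eq (NSSpinHeat.isSpaceTimeTestOn_fderiv_apply hψ v), hweak ψ hψ,
    List.length_cons, pow_succ]
  ring

/-- Restriction to a smaller open set. [folklore] -/
theorem IsRepDeriv.mono (hf : IsRepDeriv Q h vs f) (hQ : Q' ≤ Q) : IsRepDeriv Q' h vs f :=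
  ⟨hf.1.mono_set hQ, hf.2.1.mono_set hQ, fun ψ hψ => hf.2.2 ψ (hψ.mono hQ)⟩

/-- Changing the representative on a null set of `Q`. [folklore] -/
theorem IsRepDeriv.congr_ae (hf : IsRepDeriv Q h vs f) (hg : LocallyIntegrableOn g (Q : Set (ℝ × E)) volume)
    (hfg : ∀ᵐ q ∂(volume : Measure (ℝ × E)), q ∈ (Q : Set (ℝ × E)) → f q = g q) :
    IsRepDeriv Q h vs g := by
  refine ⟨hf.1, hg, fun ψ hψ => ?_⟩
  rw [hf.integral_eq hψ]
  congr 1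
  refine integral_congr_ae ?_
  filter_upwards [hfg] with q hq
  by_cases hqQ : q ∈ (Q : Set (ℝ × E))
  · rw [hq hqQ]
  · rw [hψ.apply_eq_zero hqQ, mul_zero, mul_zero]

/-- Changing the base function on a null set of `Q`. [folklore] -/
theorem IsRepDeriv.congr_base_ae {h' : ℝ × E → ℝ} (hf : IsRepDeriv Q h vs f)
    (hh' : LocallyIntegrableOn h' (Q : Set (ℝ × E)) volume)
    (hhh : ∀ᵐ q ∂(volume : Measure (ℝ × E)), q ∈ (Q : Set (ℝ × E)) → h q = h' q) :
    IsRepDeriv Q h' vs f := by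
  refine ⟨hh', hf.2.1, fun ψ hψ => ?_⟩
  rw [← hf.integral_eq hψ]
  refine integral_congr_ae ?_
  filter_upwards [hhh] with q hq
  by_cases hqQ : q ∈ (Q : Set (ℝ × E))
  · rw [hq hqQ]
  · rw [(hψ.derivs vs).apply_eq_zero hqQ, mul_zero, mul_zero]

/-- Pairings of a representative with test functions on `Q` are integrable. [folklore] -/
theorem IsRepDeriv.integrable_mul' (hf : IsRepDeriv Q h vs f) {ψ : ℝ → E → ℝ}
    (hψ : IsSpaceTimeTestOn Q ψ) : Integrable (fun q : ℝ × E => f q * ψ q.1 q.2) volume := by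
  have h1 : IntegrableOn (fun q : ℝ × E => f q * uncurry ψ q) (Q : Set (ℝ × E)) volume := by
    have h := hf.2.1.integrableOn_compact_subset hψ.tsupport_subset hψ.hasCompactSupport
    have h2 : IntegrableOn (fun q : ℝ × E => f q * uncurry ψ q) (tsupport (uncurry ψ)) volume :=
      h.mul_continuousOn hψ.contDiff.continuous.continuousOn hψ.hasCompactSupport
    refine (integrableOn_iff_integrable_of_support_subset ?_).1 h2 |>.integrableOn
    intro q hq
    exact subset_tsupport _ (right_ne_zero_of_mul (Function.mem_support.1 hq))
  refine (integrableOn_iff_integrable_of_support_subset (s := (Q : Set (ℝ × E))) ?_).1 h1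
  intro q hq
  by_contra hqQ
  exact (Function.mem_support.1 hq) (by
    show f q * ψ q.1 q.2 = 0
    rw [hψ.apply_eq_zero hqQ, mul_zero])

/-- **Uniqueness a.e.** Two representatives of the same derivative agree a.e. on `Q`
(du Bois-Reymond). [folklore] -/
theorem IsRepDeriv.ae_eq (hf : IsRepDeriv Q h vs f) (hg : IsRepDeriv Q h vs g) :
    ∀ᵐ q ∂(volume : Measure (ℝ × E)), q ∈ (Q : Set (ℝ × E)) → f q = g q := by
  have hWV : LocallyIntegrableOn (fun q => f q - g q) (Q : Set (ℝ × E)) volume := hf.2.1.sub hg.2.1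
  have key := Q.isOpen.ae_eq_zero_of_integral_contDiff_smul_eq_zero (μ := volume) hWV ?_
  · filter_upwards [key] with q hq hqQ
    exact sub_eq_zero.1 (hq hqQ)
  intro θ hθs hθc hθQ
  have hΘ : IsSpaceTimeTestOn Q (fun t x => θ (t, x)) := ⟨hθs, hθc, hθQ⟩
  have h1 := hf.integral_eq hΘ
  have h2 := hg.integral_eq hΘ
  rw [h1] at h2
  have hne : ((-1 : ℝ) ^ vs.length) ≠ 0 := pow_ne_zero _ (by norm_num)
  have h3 := mul_left_cancel₀ hne h2
  have i1 := hf.integrable_mul' hΘ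
  have i2 := hg.integrable_mul' hΘ
  calc ∫ q : ℝ × E, θ q • (f q - g q) = ∫ q : ℝ × E, (f q * θ (q.1, q.2) - g q * θ (q.1, q.2)) := by
        refine integral_congr_ae (Eventually.of_forall fun q => ?_)
        simp only [smul_eq_mul, Prod.mk.eta]
        ring
    _ = 0 := by rw [integral_sub i1 i2, h3, sub_self]

/-- **Linearity**: sums of representatives. [folklore] -/
theorem IsRepDeriv.add {h₂ f₂ : ℝ × E → ℝ} (hf : IsRepDeriv Q h vs f) (hf₂ : IsRepDeriv Q h₂ vs f₂) :
    IsRepDeriv Q (fun q => h q + h₂ q) vs (fun q => f q + f₂ q) := by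
  refine ⟨hf.1.add hf₂.1, hf.2.1.add hf₂.2.1, fun ψ hψ => ?_⟩
  have i1 := (isRepDeriv_nil hf.1).integrable_mul' (hψ.derivs vs)
  have i2 := (isRepDeriv_nil hf₂.1).integrable_mul' (hψ.derivs vs)
  have i3 := hf.integrable_mul' hψ
  have i4 := hf₂.integrable_mul' hψ
  simp only [add_mul]
  rw [integral_add i1 i2, integral_add i3 i4, hf.integral_eq hψ, hf₂.integral_eq hψ, mul_add]

/-- **Linearity**: constant multiples of representatives. [folklore] -/
theorem IsRepDeriv.const_mul (hf : IsRepDeriv Q h vs f) (a : ℝ) :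
    IsRepDeriv Q (fun q => a * h q) vs (fun q => a * f q) := by
  refine ⟨hf.1.smul a |>.congr (Eventually.of_forall fun q => by simp),
    hf.2.1.smul a |>.congr (Eventually.of_forall fun q => by simp), fun ψ hψ => ?_⟩
  simp only [mul_assoc]
  rw [integral_const_mul, integral_const_mul, hf.integral_eq hψ]
  ring

/-- **Linearity**: differences of representatives. [folklore] -/
theorem IsRepDeriv.sub {h₂ f₂ : ℝ × E → ℝ} (hf : IsRepDeriv Q h vs f) (hf₂ : IsRepDeriv Q h₂ vs f₂) :
    IsRepDeriv Q (fun q => h q - h₂ q) vs (fun q => f q - f₂ q) := by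
  have hsum := hf.add (hf₂.const_mul (-1))
  refine ⟨hsum.1.congr (Eventually.of_forall fun q => by ring),
    hsum.2.1.congr (Eventually.of_forall fun q => by ring), fun ψ hψ => ?_⟩
  have h2 := hsum.integral_eq hψ
  have e1 : ∫ q : ℝ × E, (h q + -1 * h₂ q) * derivs vs ψ q.1 q.2 =
      ∫ q : ℝ × E, (h q - h₂ q) * derivs vs ψ q.1 q.2 :=
    integral_congr_ae (Eventually.of_forall fun q => by ring)
  have e2 : ∫ q : ℝ × E, (f q + -1 * f₂ q) * ψ q.1 q.2 = ∫ q : ℝ × E, (f q - f₂ q) * ψ q.1 q.2 :=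
    integral_congr_ae (Eventually.of_forall fun q => by ring)
  rw [← e1, h2, e2]

end Rep

end RepDeriv

end Literature.Analysis.FluidPDE

end
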